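import Literature.NumberTheory.EllipticCurves.TwoDescent
import HarnessLib

/-!
# The `2`-descent class of `P + σP` for an involution `σ`: the Galois-NORM form of the chord identity (Silverman AEC X.1, proofs only)

For an elliptic curve `E/F` with rational `2`-torsion point `T₁ = (e₁, ·)` the complete `2`-descent component
`δ(P) = [x(P) − e₁] ∈ F^×/F^{×2}` is a homomorphism (Silverman AEC Prop. X.1.4; tree `twoDescentComponent_add`), via the
chord identity `(x₁ − e₁)(x₂ − e₁)(x(P₁ + P₂) − e₁) = t²` with the EXPLICIT witness `t = ℓ(e₁ − x₁) + y₁ − y_{T₁}`, `ℓ`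
the slope of the chord (tree `mul_mul_addX_sub_eq_sq`).  This file records the refinement behind the cohomological
compatibility «corestriction ∘ Kummer map = Kummer map ∘ trace» (for `μ₂`-coefficients corestriction `H¹(F, μ₂) → H¹(F₀, μ₂)`
is the NORM `F^×/F^{×2} → F₀^×/F₀^{×2}`): if `σ` is a ring endomorphism of `F` fixing the coefficients of `E` and `e₁`, and
`P₂ = σP₁` with `σ²P₁ = P₁` and `x(σP₁) ≠ x(P₁)`, then

* the slope, `x(P₁ + σP₁)`, `y(P₁ + σP₁)` and the witness `t` are all FIXED by `σ` (`slope_fixed`, `addX_fixed`, `addY_fixed`,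
  `chordWitness_fixed`), and `(x₁ − e₁)(σx₁ − e₁)` — the `σ`-norm of `x₁ − e₁` — is fixed;
* hence (`exists_fixed_sq_witness`) `(x(P₁ + σP₁) − e₁) · N_σ(x₁ − e₁) = t²` with `t` in the fixed ring of `σ`: the descent class of
  the `σ`-trace `P₁ + σP₁`, read in the FIXED FIELD `F₀ = F^σ` (not merely in `F`), is the class of the norm `N_σ(x₁ − e₁)`
  (`sqClass_sub_eq_sqClass_norm_of_descends`, for any subfield `K → F` onto which `σ`-fixed elements descend);
* degenerate case (`norm_eq_of_addX_eq`): if `P₁ + σP₁ = T₁` then `N_σ(x₁ − e₁) = (e₁ − e₂)(e₁ − e₃)` EXACTLY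
  (translation formula, tree `addX_twoTorsion_sub_mul`);
* orbit sums (`twoDescentComponent_sum`, `twoDescentComponent_sum_apply`, §4 — appended): the class of `Σᵢ σᵢP` in `F^×/F^{×2}` is the
  class of `∏ᵢ (σᵢx − e₁)`; for an odd-order group read it in the fixed field with `Literature.FieldTheory.Kummer.sqClass_algebraMap_injective`.

Use (the prover's note): iterating over a tower of quadratic steps this gives, for a `2`-group (e.g. genus theory) acting on
`E(H)`, that the Kummer class over the fixed field of a trace `Σ_g P^g` is the norm of the Kummer class of `P` — the first step of
reading the `2`-descent class of a Heegner-point trace (a genus period) as the norm of the square class of `x(z) − e₁`.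
PROOFS ONLY: no `def`, no named fact; general Weierstrass equations (`a₁, a₃` arbitrary), `CharZero F`.

References: [cite: SilvermanAEC2009, Prop. X.1.4 and Thm. X.1.1 (the Kummer pairing); Exercise 10.1];
[cite: NeukirchSchmidtWingberg2008, Prop. 1.5.3 (iii)–(iv) (cor ∘ res, res ∘ cor) and §1.5 (corestriction on H¹ with trivial action = norm/transfer)];
tree `Literature/NumberTheory/EllipticCurves/TwoDescent.lean` (`mul_mul_addX_sub_eq_sq`, `addX_twoTorsion_sub_mul`, `sqClass`).
-/

noncomputable section

namespace WeierstrassCurve.Affine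

variable {F : Type*} [Field F] {W : Affine F} {e₁ e₂ e₃ : F}

/-! ## §1 A ring endomorphism fixing the coefficients preserves the equation -/

section Transport

variable (σ : F →+* F)

/-- A ring endomorphism of `F` fixing `a₁, a₂, a₃, a₄, a₆` maps solutions of the Weierstrass equation to solutions.
[cite: SilvermanAEC2009, III.1 (the Weierstrass equation) — folklore Galois transport] -/
theorem equation_apply_of_fixed (ha₁ : σ W.a₁ = W.a₁) (ha₂ : σ W.a₂ = W.a₂) (ha₃ : σ W.a₃ = W.a₃) (ha₄ : σ W.a₄ = W.a₄)
    (ha₆ : σ W.a₆ = W.a₆) {x y : F} (hxy : W.Equation x y) : W.Equation (σ x) (σ y) := by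
  rw [equation_iff] at hxy ⊢
  have key := congrArg σ hxy
  simp only [map_add, map_mul, map_pow, ha₁, ha₂, ha₃, ha₄, ha₆] at key
  exact key

/-- On an elliptic curve (`Δ ≠ 0`) the transported solution is a nonsingular point. [cite: SilvermanAEC2009, III.1, Prop. III.1.4] -/
theorem nonsingular_apply_of_fixed [W.IsElliptic] (ha₁ : σ W.a₁ = W.a₁) (ha₂ : σ W.a₂ = W.a₂) (ha₃ : σ W.a₃ = W.a₃)
    (ha₄ : σ W.a₄ = W.a₄) (ha₆ : σ W.a₆ = W.a₆) {x y : F} (hxy : W.Nonsingular x y) : W.Nonsingular (σ x) (σ y) :=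
  equation_iff_nonsingular.mp (equation_apply_of_fixed σ ha₁ ha₂ ha₃ ha₄ ha₆ hxy.1)

end Transport

/-! ## §2 `σ`-fixedness of the chord data for the pair `(P, σP)` when `σ²P = P` -/

section Fixed

variable [DecidableEq F] (σ : F →+* F)

/-- The slope of the chord through `P = (x₁, y₁)` and `σP` is fixed by `σ` (when `σ²P = P`, `x(σP) ≠ x(P)`).
[cite: SilvermanAEC2009, III.2.3 (the chord slope)] -/
theorem slope_fixed {x₁ y₁ : F} (hσx : σ (σ x₁) = x₁) (hσy : σ (σ y₁) = y₁) (hx : σ x₁ ≠ x₁) :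
    σ (W.slope x₁ (σ x₁) y₁ (σ y₁)) = W.slope x₁ (σ x₁) y₁ (σ y₁) := by
  rw [slope_of_X_ne (Ne.symm hx), map_div₀, map_sub, map_sub, hσx, hσy]
  rw [← neg_sub y₁ (σ y₁), ← neg_sub x₁ (σ x₁), neg_div_neg_eq]

/-- `x(P + σP)` is fixed by `σ` (`σ` fixes `a₁, a₂`). [cite: SilvermanAEC2009, III.2.3 (group law, x₃ = λ² + a₁λ − a₂ − x₁ − x₂)] -/
theorem addX_fixed (ha₁ : σ W.a₁ = W.a₁) (ha₂ : σ W.a₂ = W.a₂) {x₁ y₁ : F} (hσx : σ (σ x₁) = x₁) (hσy : σ (σ y₁) = y₁)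
    (hx : σ x₁ ≠ x₁) :
    σ (W.addX x₁ (σ x₁) (W.slope x₁ (σ x₁) y₁ (σ y₁))) = W.addX x₁ (σ x₁) (W.slope x₁ (σ x₁) y₁ (σ y₁)) := by
  have hL := slope_fixed (W := W) σ hσx hσy hx
  simp only [addX, map_sub, map_add, map_mul, map_pow, hL, ha₁, ha₂, hσx]
  ring

/-- The key linear relation: `ℓ · (x₁ − σx₁) = y₁ − σy₁` for the chord slope `ℓ`. [cite: SilvermanAEC2009, III.2.3] -/
theorem slope_mul_sub {x₁ y₁ : F} (hx : σ x₁ ≠ x₁) :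
    W.slope x₁ (σ x₁) y₁ (σ y₁) * (x₁ - σ x₁) = y₁ - σ y₁ := by
  rw [slope_of_X_ne (Ne.symm hx), div_mul_cancel₀ _ (sub_ne_zero.mpr (Ne.symm hx))]

/-- `y(P + σP)` is fixed by `σ` (`σ` fixes `a₁, a₂, a₃`). [cite: SilvermanAEC2009, III.2.3 (group law, y₃)] -/
theorem addY_fixed (ha₁ : σ W.a₁ = W.a₁) (ha₂ : σ W.a₂ = W.a₂) (ha₃ : σ W.a₃ = W.a₃) {x₁ y₁ : F} (hσx : σ (σ x₁) = x₁)
    (hσy : σ (σ y₁) = y₁) (hx : σ x₁ ≠ x₁) :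
    σ (W.addY x₁ (σ x₁) y₁ (W.slope x₁ (σ x₁) y₁ (σ y₁))) = W.addY x₁ (σ x₁) y₁ (W.slope x₁ (σ x₁) y₁ (σ y₁)) := by
  have hL := slope_fixed (W := W) σ hσx hσy hx
  have hX := addX_fixed (W := W) σ ha₁ ha₂ hσx hσy hx
  have hrel := slope_mul_sub (W := W) σ (y₁ := y₁) hx
  simp only [addY, negAddY, negY, map_sub, map_add, map_mul, map_neg, hL, hX, ha₁, ha₃]
  linear_combination -hrel

/-- **The chord witness `t = ℓ(e₁ − x₁) + y₁ − y_{T₁}` is fixed by `σ`** (`σ` fixes `a₁, a₃, e₁`; `σ²P = P`).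
[cite: SilvermanAEC2009, Prop. X.1.4 (proof via Thm. X.1.1)] -/
theorem chordWitness_fixed (ha₁ : σ W.a₁ = W.a₁) (ha₃ : σ W.a₃ = W.a₃) (he₁ : σ e₁ = e₁) {x₁ y₁ : F}
    (hσx : σ (σ x₁) = x₁) (hσy : σ (σ y₁) = y₁) (hx : σ x₁ ≠ x₁) :
    σ (W.slope x₁ (σ x₁) y₁ (σ y₁) * (e₁ - x₁) + y₁ - W.twoTorsionY e₁) =
      W.slope x₁ (σ x₁) y₁ (σ y₁) * (e₁ - x₁) + y₁ - W.twoTorsionY e₁ := by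
  have hL := slope_fixed (W := W) σ hσx hσy hx
  have hrel := slope_mul_sub (W := W) σ (y₁ := y₁) hx
  simp only [twoTorsionY, map_sub, map_add, map_mul, map_neg, map_div₀, map_ofNat, hL, ha₁, ha₃, he₁]
  linear_combination hrel

omit [DecidableEq F] in
/-- The `σ`-norm `(x₁ − e₁)(σx₁ − e₁)` is fixed by `σ` (the norm of a Kummer generator lies in the fixed field).
[cite: SilvermanAEC2009, Thm. X.1.1 (Kummer pairing), Prop. X.1.4] -/
theorem norm_sub_fixed (he₁ : σ e₁ = e₁) {x₁ : F} (hσx : σ (σ x₁) = x₁) :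
    σ ((x₁ - e₁) * (σ x₁ - e₁)) = (x₁ - e₁) * (σ x₁ - e₁) := by
  rw [map_mul, map_sub, map_sub, he₁, hσx, mul_comm]

/-- **THE NORM FORM OF THE CHORD IDENTITY.**  `E/F` elliptic with rational `2`-torsion `e₁, e₂, e₃`; `σ` a ring endomorphism of `F`
fixing `a₁, …, a₆` and `e₁`; `P = (x₁, y₁) ∈ E(F)` with `σ²P = P` and `x(σP) ≠ x(P)`.  Then
`(x₁ − e₁)(σx₁ − e₁) · (x(P + σP) − e₁) = t²` for an element `t` FIXED by `σ`; and `x(P + σP)`, `(x₁ − e₁)(σx₁ − e₁)` are fixed by `σ`.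
(So in the fixed field `F^σ` the descent class of the trace `P + σP` is the class of the norm of `x₁ − e₁`.)
[cite: SilvermanAEC2009, Prop. X.1.4, Thm. X.1.1] [cite: NeukirchSchmidtWingberg2008, §1.5 (corestriction)] -/
theorem exists_fixed_sq_witness [CharZero F] [W.IsElliptic] (h : W.SplitTwoTorsion e₁ e₂ e₃)
    (ha₁ : σ W.a₁ = W.a₁) (ha₂ : σ W.a₂ = W.a₂) (ha₃ : σ W.a₃ = W.a₃) (ha₄ : σ W.a₄ = W.a₄) (ha₆ : σ W.a₆ = W.a₆)
    (he₁ : σ e₁ = e₁) {x₁ y₁ : F} (h₁ : W.Nonsingular x₁ y₁) (hσx : σ (σ x₁) = x₁) (hσy : σ (σ y₁) = y₁) (hx : σ x₁ ≠ x₁) :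
    σ (W.addX x₁ (σ x₁) (W.slope x₁ (σ x₁) y₁ (σ y₁))) = W.addX x₁ (σ x₁) (W.slope x₁ (σ x₁) y₁ (σ y₁)) ∧
    σ ((x₁ - e₁) * (σ x₁ - e₁)) = (x₁ - e₁) * (σ x₁ - e₁) ∧
    ∃ t : F, σ t = t ∧
      (x₁ - e₁) * (σ x₁ - e₁) * (W.addX x₁ (σ x₁) (W.slope x₁ (σ x₁) y₁ (σ y₁)) - e₁) = t ^ 2 := by
  have h₂ : W.Nonsingular (σ x₁) (σ y₁) := nonsingular_apply_of_fixed σ ha₁ ha₂ ha₃ ha₄ ha₆ h₁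
  have hxy : ¬(x₁ = σ x₁ ∧ y₁ = W.negY (σ x₁) (σ y₁)) := fun hc => hx hc.1.symm
  exact ⟨addX_fixed σ ha₁ ha₂ hσx hσy hx, norm_sub_fixed σ he₁ hσx,
    _, chordWitness_fixed σ ha₁ ha₃ he₁ hσx hσy hx, mul_mul_addX_sub_eq_sq h h₁ h₂ hxy⟩

/-- **Degenerate case**: if the chord point `P + σP` is the `2`-torsion point `T₁` itself (`x(P + σP) = e₁`), then the norm is
EXACTLY the descent value at `T₁`: `(x₁ − e₁)(σx₁ − e₁) = (e₁ − e₂)(e₁ − e₃)` (so the class identity «trace ↦ norm» also holds there,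
where the chord witness degenerates to `t = 0`).  Proof: `σP = T₁ − P = −(P + T₁)` has the abscissa of `P + T₁`, and the translation
formula `(x(P + T₁) − e₁)(x₁ − e₁) = (e₁ − e₂)(e₁ − e₃)` (tree `addX_twoTorsion_sub_mul`). [cite: SilvermanAEC2009, Prop. X.1.4 (value at T₁)] -/
theorem norm_eq_of_addX_eq [CharZero F] [W.IsElliptic] (h : W.SplitTwoTorsion e₁ e₂ e₃)
    (ha₁ : σ W.a₁ = W.a₁) (ha₂ : σ W.a₂ = W.a₂) (ha₃ : σ W.a₃ = W.a₃) (ha₄ : σ W.a₄ = W.a₄) (ha₆ : σ W.a₆ = W.a₆)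
    (he₁ : σ e₁ = e₁) {x₁ y₁ : F} (h₁ : W.Nonsingular x₁ y₁) (hx : σ x₁ ≠ x₁)
    (hT : W.addX x₁ (σ x₁) (W.slope x₁ (σ x₁) y₁ (σ y₁)) = e₁) :
    (x₁ - e₁) * (σ x₁ - e₁) = (e₁ - e₂) * (e₁ - e₃) := by
  have h₂ : W.Nonsingular (σ x₁) (σ y₁) := nonsingular_apply_of_fixed σ ha₁ ha₂ ha₃ ha₄ ha₆ h₁
  have hx' : x₁ ≠ σ x₁ := Ne.symm hx
  have hx1 : x₁ ≠ e₁ := by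
    rintro rfl
    exact hx he₁
  -- the three points
  set P : W.Point := Point.some x₁ y₁ h₁ with hP
  set Q : W.Point := Point.some (σ x₁) (σ y₁) h₂ with hQ
  set T : W.Point := Point.some e₁ (W.twoTorsionY e₁) (nonsingular_twoTorsion h) with hTdef
  -- `y(P + σP) = y_{T₁}` since its abscissa is `e₁`
  have h3 : W.Nonsingular (W.addX x₁ (σ x₁) (W.slope x₁ (σ x₁) y₁ (σ y₁)))
      (W.addY x₁ (σ x₁) y₁ (W.slope x₁ (σ x₁) y₁ (σ y₁))) := nonsingular_add h₁ h₂ fun hc => hx' hc.1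
  rw [hT] at h3
  have hy : W.addY x₁ (σ x₁) y₁ (W.slope x₁ (σ x₁) y₁ (σ y₁)) = W.twoTorsionY e₁ := eq_twoTorsionY_of_eq h h3
  have hsum : P + Q = T := by
    rw [hP, hQ, Point.add_of_X_ne hx', hTdef]
    congr 1
  have hTT : -T = T := by
    rw [hTdef, Point.neg_some]
    congr 1
    exact negY_twoTorsionY e₁
  have hQ' : Q = -(P + T) := by
    have h1 : Q = T - P := by rw [← hsum]; abel
    rw [h1, neg_add, hTT]
    abel
  -- abscissa of `−(P + T₁)` is that of `P + T₁`
  rw [hP, hTdef, Point.add_of_X_ne hx1, Point.neg_some, hQ] at hQ'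
  obtain ⟨hxQ, -⟩ := Point.some.inj hQ'
  rw [hxQ, mul_comm]
  exact addX_twoTorsion_sub_mul h h₁ hx1

end Fixed

/-! ## §3 Descent to a subfield onto which the `σ`-fixed elements descend: the class identity in `K^×/K^{×2}` -/

section Descent

variable [DecidableEq F] {K : Type*} [Field K] [Algebra K F] (σ : F →ₐ[K] F)

/-- **THE TRACE–NORM CLASS IDENTITY IN THE FIXED FIELD.**  In the situation of `exists_fixed_sq_witness` with `σ` a `K`-algebra
endomorphism of `F` (so `σ` fixes `K`), suppose every `σ`-fixed element of `F` lies in (the image of) `K`, and `x(P + σP) ≠ e₁`.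
Then for the descended elements `x₃, N ∈ K` of `x(P + σP)` and of the norm `(x₁ − e₁)(σx₁ − e₁)`, and `e₁ = e₁′ ∈ K`:
**`[x₃ − e₁′] = [N]` in `K^×/K^{×2}`** — the `2`-descent class over `K` of the `σ`-trace is the class of the NORM (an identity modulo
squares of `K`, not merely of the big field `F`).
[cite: SilvermanAEC2009, Prop. X.1.4, Thm. X.1.1] [cite: NeukirchSchmidtWingberg2008, §1.5 (corestriction on H¹ = norm)] -/
theorem sqClass_sub_eq_sqClass_norm_of_descends [CharZero F] [W.IsElliptic] (h : W.SplitTwoTorsion e₁ e₂ e₃)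
    (ha₁ : σ W.a₁ = W.a₁) (ha₂ : σ W.a₂ = W.a₂) (ha₃ : σ W.a₃ = W.a₃) (ha₄ : σ W.a₄ = W.a₄) (ha₆ : σ W.a₆ = W.a₆)
    (hfix : ∀ z : F, σ z = z → ∃ k : K, algebraMap K F k = z)
    {e₁' : K} (he₁ : algebraMap K F e₁' = e₁)
    {x₁ y₁ : F} (h₁ : W.Nonsingular x₁ y₁) (hσx : σ (σ x₁) = x₁) (hσy : σ (σ y₁) = y₁) (hx : σ x₁ ≠ x₁)
    {x₃ N : K} (hx₃ : algebraMap K F x₃ = W.addX x₁ (σ x₁) (W.slope x₁ (σ x₁) y₁ (σ y₁)))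
    (hN : algebraMap K F N = (x₁ - e₁) * (σ x₁ - e₁))
    (hne : W.addX x₁ (σ x₁) (W.slope x₁ (σ x₁) y₁ (σ y₁)) ≠ e₁) :
    sqClass (x₃ - e₁') = sqClass N := by
  have hinj : Function.Injective (algebraMap K F) := (algebraMap K F).injective
  have he₁σ : σ e₁ = e₁ := by rw [← he₁]; exact σ.commutes e₁'
  obtain ⟨-, -, t, ht, hsq⟩ :=
    exists_fixed_sq_witness (σ : F →+* F) h ha₁ ha₂ ha₃ ha₄ ha₆ he₁σ h₁ hσx hσy hx
  have ht' : σ t = t := ht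
  have hsq' : (x₁ - e₁) * (σ x₁ - e₁) * (W.addX x₁ (σ x₁) (W.slope x₁ (σ x₁) y₁ (σ y₁)) - e₁) = t ^ 2 := hsq
  obtain ⟨tK, htK⟩ := hfix t ht'
  -- the identity descends to `K`
  have hK : (x₃ - e₁') * N = tK ^ 2 := by
    apply hinj
    rw [map_mul, map_sub, map_pow, hx₃, he₁, hN, htK, ← hsq']
    ring
  have hx1 : x₁ ≠ e₁ := by
    rintro rfl
    exact hx he₁σ
  have hx2 : σ x₁ ≠ e₁ := by
    intro h2
    apply hx1
    rw [← hσx, h2, he₁σ]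
  have hN0 : N ≠ 0 := by
    intro h0
    rw [h0, map_zero] at hN
    exact mul_ne_zero (sub_ne_zero.mpr hx1) (sub_ne_zero.mpr hx2) hN.symm
  have hx0 : x₃ - e₁' ≠ 0 := by
    intro h0
    apply hne
    rw [← hx₃, ← he₁, sub_eq_zero.mp h0]
  have hprod : sqClass (x₃ - e₁') * sqClass N = 1 := by
    rw [← sqClass_mul hx0 hN0, hK, sqClass_sq]
  rw [SqUnits.eq_mul_of_mul_eq hprod, SqUnits.one_mul]

end Descent

/-! ## §4 Orbit sums: the descent class of a finite sum is the product of the classes (the odd-order step's input) -/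

section OrbitSum

variable [DecidableEq F] [CharZero F] [W.IsElliptic]

/-- **The `2`-descent class of a finite sum is the product of the classes** (Silverman X.1.4: `δ` is a homomorphism; tree
`twoDescentComponent_add`, iterated over a `Finset`).  For an orbit sum `Σ_{g∈G} P^g` this reads: its class in `F^×/F^{×2}` is the class of
`∏_g (x(P^g) − e₁)`, the `G`-norm of `x(P) − e₁`; when `|G|` is ODD and both the sum's abscissa and the norm lie in the fixed field `K = F^G`,
`Literature.FieldTheory.Kummer.sqClass_algebraMap_injective` (`[F:K]` odd) upgrades this to an identity in `K^×/K^{×2}` — the odd-order step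
complementary to the involution step `exists_fixed_sq_witness`. [cite: SilvermanAEC2009, Prop. X.1.4] -/
theorem twoDescentComponent_sum (h : W.SplitTwoTorsion e₁ e₂ e₃) {ι : Type*} (s : Finset ι) (P : ι → W.Point) :
    Point.twoDescentComponent W e₁ e₂ e₃ (∑ i ∈ s, P i) = ∏ i ∈ s, Point.twoDescentComponent W e₁ e₂ e₃ (P i) := by
  classical
  induction s using Finset.induction_on with
  | empty => rw [Finset.sum_empty, Finset.prod_empty, Point.twoDescentComponent_zero]
  | insert i s hi ih => rw [Finset.sum_insert hi, Finset.prod_insert hi, Point.twoDescentComponent_add h, ih]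

/-- **Orbit-sum form**: for a finite family of ring endomorphisms `σᵢ` fixing the coefficients, and a point `P = (x, y)` none of whose
images `(σᵢ x, σᵢ y)` has abscissa `e₁`, the class of `Σᵢ σᵢP` is the class of the product `∏ᵢ (σᵢ x − e₁)` (in `F^×/F^{×2}`).
[cite: SilvermanAEC2009, Prop. X.1.4] -/
theorem twoDescentComponent_sum_apply (h : W.SplitTwoTorsion e₁ e₂ e₃) {ι : Type*} (s : Finset ι) (σ : ι → (F →+* F))
    (ha₁ : ∀ i, σ i W.a₁ = W.a₁) (ha₂ : ∀ i, σ i W.a₂ = W.a₂) (ha₃ : ∀ i, σ i W.a₃ = W.a₃) (ha₄ : ∀ i, σ i W.a₄ = W.a₄)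
    (ha₆ : ∀ i, σ i W.a₆ = W.a₆) {x y : F} (hP : W.Nonsingular x y) (hx : ∀ i ∈ s, σ i x ≠ e₁) :
    Point.twoDescentComponent W e₁ e₂ e₃
        (∑ i ∈ s, Point.some (σ i x) (σ i y) (nonsingular_apply_of_fixed (σ i) (ha₁ i) (ha₂ i) (ha₃ i) (ha₄ i) (ha₆ i) hP)) =
      ∏ i ∈ s, sqClass (σ i x - e₁) := by
  rw [twoDescentComponent_sum h]
  exact Finset.prod_congr rfl fun i hi => Point.twoDescentComponent_some_of_ne _ (hx i hi)

end OrbitSum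


end WeierstrassCurve.Affine

end
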